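import Summits.Ventures.PercRepro.RankLevelSetNullitySplitK

/-!
# PercRepro — THE `N`-SIDE WITH THE BONFERRONI CORRECTION AT LEVEL `7`: `nsideTelK7` (p8, gen 21; a feeder for S4 — the top of
the `q = 7` window, the row `43`)

In the telescoping count the level-`7` sets are the independent `7`-sets and the level-`8` sets are bounded by the pair count
`Π′ = s₃·C(n − 3, 5) + s₄·C(n − 4, 4) + …`. The `7`-sets containing a triangle are dependent
(S1IndepSevenCount: `#{independent 7-sets} + s₃·C(n − 3, 4) ≤ C(n, 7) + C(s₃, 2)·(1 + n + C(n, 2))`), so the two levels together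
are at most `C(n, 7) + s₃·(C(n − 3, 5) − C(n − 3, 4)) + C(s₃, 2)·(1 + n + C(n, 2)) + s₄·C(n − 4, 4) + …` — monotone in `s₃`.
**`nsideTelK7 p d k S3 S4 S5`** = that, plus the levels `9 … d` of the telescoping count (`lamTel … (j + 2)`, the caps `k` smaller)
and the powerset term `2^{min 79 (7 + d − k)}`. At `(43, 8)` the `s₃`-term of the pair count is `20 %` of the budget and the
correction takes `5/(n − 7) ≈ 11 %` of it off. Axioms: standard.
-/

namespace PercRepro

namespace ThmN

/-- **The `N`-side with the Bonferroni correction at level `7`** (`nsideTelK` with the levels `7` and `8` written out). -/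
def nsideTelK7 (p d k S3 S4 S5 : ℕ) : ℚ :=
  (((p + d).choose 7 : ℕ) : ℚ) +
    (((S3 : ℕ) : ℚ) * ((((p + d - 3).choose 5 - (p + d - 3).choose 4 : ℕ)) : ℚ) +
      ((S3.choose 2 : ℕ) : ℚ) * (((1 + (p + d) + (p + d).choose 2 : ℕ)) : ℚ) +
      ((S4 : ℕ) : ℚ) * (((p + d - 4).choose 4 : ℕ) : ℚ) + ((S5 : ℕ) : ℚ) * (((p + d - 5).choose 3 : ℕ) : ℚ) +
      (((d + 5).choose 6 : ℕ) : ℚ) * (((p + d - 6).choose 2 : ℕ) : ℚ) +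
      (((d + 6).choose 7 : ℕ) : ℚ) * (((p + d - 7 : ℕ)) : ℚ) + (((d + 7).choose 8 : ℕ) : ℚ)) +
    (∑ j ∈ Finset.range (d - 8), S2.lamTel (((p + d).choose 7 : ℕ) : ℚ)
      (((S3 : ℕ) : ℚ) * (((p + d - 3).choose 5 : ℕ) : ℚ) + ((S4 : ℕ) : ℚ) * (((p + d - 4).choose 4 : ℕ) : ℚ) +
        ((S5 : ℕ) : ℚ) * (((p + d - 5).choose 3 : ℕ) : ℚ) +
        (((d + 5).choose 6 : ℕ) : ℚ) * (((p + d - 6).choose 2 : ℕ) : ℚ) +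
        (((d + 6).choose 7 : ℕ) : ℚ) * (((p + d - 7 : ℕ)) : ℚ) + (((d + 7).choose 8 : ℕ) : ℚ))
      (min (min 79 (7 + d - k) - 8) (max ((d + min 33 d) / 2 + 1) (min 32 (d - 1) + 2) - 2))
      (fun ν => ν + S2.rminF ν) (j + 2)) +
    (2 : ℚ) ^ (min 79 (7 + d - k))

end ThmN

end PercRepro
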